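import Mathlib.MeasureTheory.Integral.IntegralEqImproper
import Mathlib.Analysis.SpecialFunctions.Log.Deriv
import Mathlib.LinearAlgebra.Matrix.Hadamard
import Literature.LinearAlgebra.Matrix.HermitianCfcDiagonalForm
import Literature.LinearAlgebra.Matrix.PosSemidefTrace
import Literature.Analysis.Complex.LoewnerMatrixCalculus
import Literature.Analysis.Complex.LoewnerFastTrackLoewnerMatrix
import HarnessLib

/-!
# The Fréchet derivative of the matrix logarithm (Loewner–Hadamard / Daleckiĭ–Kreĭn form) and
# the first-order (supporting-hyperplane) inequality of the operator concave function `log`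

Topic `LinearAlgebra/Matrix`, namespace `Literature.LinearAlgebra.Matrix`.

For a positive definite complex matrix `A₀ = V diag(μ) V⋆` (ANY unitary diagonalisation: `V`
unitary, `μₖ > 0`) the derivative of the matrix logarithm at `A₀` is the linear map
`E ↦ dlog_{A₀}[E] = V (L ∘ (V⋆ E V)) V⋆`, where `∘` is the entrywise (Hadamard/Schur) product and
`L = (dd1 log μᵢ μⱼ)ᵢⱼ` is the LOEWNER MATRIX of `log` at the eigenvalues
(`Lᵢⱼ = (log μᵢ − log μⱼ)/(μᵢ − μⱼ)`, `Lᵢᵢ = 1/μᵢ`; Petz, *Quantum Information Theory and Quantum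
Statistics*, Example 11.7, eqs. (11.12)–(11.13); Lieb 1973, eq. (3.6): `d/dx log(A + xK)|₀ = T_A(K)`
with `T_A(K) = ∫₀^∞ (A + s)⁻¹ K (A + s)⁻¹ ds`, eq. (3.3)). We do NOT differentiate; everything below is
stated and proved as algebra plus the two scalar integrals
`∫₀^∞ ds/((s+a)(s+b)) = dd1 log a b` and `∫₀^∞ (1/(s+1) − 1/(s+x)) ds = log x`
(Petz, Example 11.16; Lieb 1973, eq. (3.7)).

* `logLoewnerMatrix μ`, `logFrechet V μ E` — the two objects (definitions with bodies; the first
  divided difference `dd1` is the tree's `Literature.Analysis.Complex.dd1`, not re-declared).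
* `re_star_dotProduct_logFrechet_mulVec_eq_integral` — the RESOLVENT FORM
  `Re⟨v, dlog_{A₀}[E] v⟩ = ∫₀^∞ Re⟨v, (A₀+s)⁻¹ E (A₀+s)⁻¹ v⟩ ds` (so `logFrechet` does not depend on
  the chosen diagonalisation). [cite: Lieb1973ConvexTrace, eqs. (3.3), (3.6)]
* `re_star_dotProduct_log_mulVec_eq_integral` — `Re⟨v, log A v⟩ = ∫₀^∞ (‖v‖²/(s+1) − Re⟨v,(A+s)⁻¹v⟩) ds`.
  [cite: Petz2008, Example 11.16] [cite: Lieb1973ConvexTrace, eq. (3.7)]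
* **`posSemidef_log_add_logFrechet_sub_log`** — the FIRST-ORDER CONCAVITY (tangent) INEQUALITY
  `log A ≤ log A₀ + dlog_{A₀}[A − A₀]` (Löwner order) for all positive definite `A, A₀`: the
  supporting-hyperplane form of the operator concavity of `log` (Petz, Example 11.16 and §11.6:
  "the integral formula gives that `log` is operator concave"), proved pointwise in `s` from
  `⟨v,(A+s)⁻¹v⟩ ≥ 2 Re⟨u, v⟩ − ⟨u, (A+s) u⟩` at `u = (A₀+s)⁻¹ v` and integrated.
* `logFrechet_self` (`dlog_{A₀}[A₀] = 1`), `trace_mul_logFrechet_comm` (trace-self-adjointness),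
  `posSemidef_logFrechet` / `logFrechet_mono` (positivity: `0 ≤ E ⇒ 0 ≤ dlog[E]`, WITHOUT the Schur
  product theorem — it is the integral of congruences), `posSemidef_logLoewnerMatrix` (the Loewner
  matrix of `log` is positive semidefinite; Petz, Theorem 11.17 for the operator monotone `log`).

Consumers: Lieb's concavity theorem / triple-matrix inequality and the conditional-free-energy
("Lieb constant") certificates of the Hubbard `T > 0` cell
(`Literature/MathematicalPhysics/QuantumLattice/LiebConcavity.lean`).

## References

* E. H. Lieb, *Convex trace functions and the Wigner–Yanase–Dyson conjecture*, Adv. Math. 11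
  (1973) 267–288, eqs. (3.3), (3.6), (3.7). [Lieb1973ConvexTrace]
* D. Petz, *Quantum Information Theory and Quantum Statistics* (Springer 2008), Example 11.7
  (11.12)–(11.13), Example 11.16, Theorem 11.17. [Petz2008]

## Mathlib / tree

`cfc` on `Matrix n n ℂ`; tree: `cfc_eq_conj_diagonal` (functional calculus from any unitary
diagonalisation, `HermitianCfcDiagonalForm.lean`), `dd1`/`dd1_of_ne` (`LoewnerDefs`,
`LoewnerMatrixCalculus`), `posSemidef_of_re_star_dotProduct_mulVec_nonneg`; Mathlib:
`integral_Ioi_of_hasDerivAt_of_nonneg'`, `integrableOn_Ioi_deriv_of_nonneg'`.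
-/

noncomputable section

open Matrix Filter MeasureTheory
open Set hiding diagonal
open scoped Topology ComplexOrder MatrixOrder

namespace Literature.LinearAlgebra.Matrix

open Literature.Analysis.Complex (dd1 dd1_of_ne dd1_comm posSemidef_of_re_star_dotProduct_mulVec_nonneg)

variable {n : Type*} [Fintype n] [DecidableEq n]

/-! ### The two scalar integrals -/

section Scalar

/-- `dd1 log a a = a⁻¹` (the diagonal of the Loewner matrix of `log`). [cite: Petz2008, Example 11.7 eq. (11.13)] -/
theorem dd1_log_self (a : ℝ) : dd1 Real.log a a = a⁻¹ := by
  simp [dd1]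

/-- `log (s + a) − log (s + b) → 0` as `s → +∞`. [folklore] -/
private theorem tendsto_log_add_sub_log_add (a b : ℝ) :
    Tendsto (fun s : ℝ => Real.log (s + a) - Real.log (s + b)) atTop (𝓝 0) := by
  have h1 : Tendsto (fun s : ℝ => (s + a) / (s + b)) atTop (𝓝 1) := by
    have hb : Tendsto (fun s : ℝ => s + b) atTop atTop := tendsto_atTop_add_const_right _ _ tendsto_id
    have h2 : Tendsto (fun s : ℝ => 1 + (a - b) / (s + b)) atTop (𝓝 (1 + 0)) :=
      tendsto_const_nhds.add (tendsto_const_nhds.div_atTop hb)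
    rw [add_zero] at h2
    refine h2.congr' ?_
    filter_upwards [hb.eventually_gt_atTop 0] with s hs
    field_simp
    ring
  have h3 : Tendsto (fun s : ℝ => Real.log ((s + a) / (s + b))) atTop (𝓝 0) := by
    have := ((Real.continuousAt_log one_ne_zero).tendsto).comp h1
    rw [Real.log_one] at this
    exact this
  refine h3.congr' ?_
  filter_upwards [eventually_gt_atTop (-a), eventually_gt_atTop (-b)] with s ha hb
  have ha' : 0 < s + a := by linarith
  have hb' : 0 < s + b := by linarith
  rw [Real.log_div ha'.ne' hb'.ne']

/-- `∫₀^∞ ds/((s+a)(s+b)) = dd1 log a b` for `0 < a ≠ b` (and the integrand is integrable).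
[cite: Lieb1973ConvexTrace, eq. (3.7)] -/
theorem integral_inv_mul_inv_of_ne {a b : ℝ} (ha : 0 < a) (hb : 0 < b) (hab : a ≠ b) :
    IntegrableOn (fun s : ℝ => ((s + a) * (s + b))⁻¹) (Ioi 0) ∧
    ∫ s in Ioi (0:ℝ), ((s + a) * (s + b))⁻¹ = dd1 Real.log a b := by
  have hba : b - a ≠ 0 := sub_ne_zero.mpr (Ne.symm hab)
  have hderiv : ∀ s ∈ Ici (0:ℝ), HasDerivAt (fun s : ℝ => (Real.log (s + a) - Real.log (s + b)) / (b - a))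
      (((s + a) * (s + b))⁻¹) s := by
    intro s hs
    have hsa : s + a ≠ 0 := (add_pos_of_nonneg_of_pos hs ha).ne'
    have hsb : s + b ≠ 0 := (add_pos_of_nonneg_of_pos hs hb).ne'
    have h1 : HasDerivAt (fun s : ℝ => Real.log (s + a)) ((s + a)⁻¹) s := by
      have := ((hasDerivAt_id s).add_const a).log hsa
      simpa using this
    have h2 : HasDerivAt (fun s : ℝ => Real.log (s + b)) ((s + b)⁻¹) s := by
      have := ((hasDerivAt_id s).add_const b).log hsb
      simpa using this
    have h12 : HasDerivAt (fun s : ℝ => Real.log (s + a) - Real.log (s + b))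
        ((s + a)⁻¹ - (s + b)⁻¹) s := h1.sub h2
    refine (h12.div_const (b - a)).congr_deriv ?_
    rw [inv_sub_inv hsa hsb, div_div, div_eq_iff (mul_ne_zero (mul_ne_zero hsa hsb) hba)]
    field_simp
    ring
  have hpos : ∀ s ∈ Ioi (0:ℝ), 0 ≤ ((s + a) * (s + b))⁻¹ := fun s hs =>
    inv_nonneg.mpr (mul_nonneg (add_pos hs ha).le (add_pos hs hb).le)
  have hlim : Tendsto (fun s : ℝ => (Real.log (s + a) - Real.log (s + b)) / (b - a)) atTop (𝓝 0) := by
    simpa using (tendsto_log_add_sub_log_add a b).div_const (b - a)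
  refine ⟨integrableOn_Ioi_deriv_of_nonneg' hderiv hpos hlim, ?_⟩
  rw [integral_Ioi_of_hasDerivAt_of_nonneg' hderiv hpos hlim, dd1_of_ne _ hab]
  simp only [zero_add]
  field_simp
  ring

/-- `∫₀^∞ ds/(s+a)² = 1/a = dd1 log a a` for `a > 0`. [cite: Lieb1973ConvexTrace, eq. (3.7)] -/
theorem integral_inv_mul_inv_self {a : ℝ} (ha : 0 < a) :
    IntegrableOn (fun s : ℝ => ((s + a) * (s + a))⁻¹) (Ioi 0) ∧
    ∫ s in Ioi (0:ℝ), ((s + a) * (s + a))⁻¹ = dd1 Real.log a a := by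
  have hderiv : ∀ s ∈ Ici (0:ℝ), HasDerivAt (fun s : ℝ => -(s + a)⁻¹) (((s + a) * (s + a))⁻¹) s := by
    intro s hs
    have hsa : s + a ≠ 0 := (add_pos_of_nonneg_of_pos hs ha).ne'
    have h1 : HasDerivAt (fun s : ℝ => (s + a)⁻¹) (-(1:ℝ) / (s + a) ^ 2) s :=
      ((hasDerivAt_id s).add_const a).inv hsa
    refine h1.neg.congr_deriv ?_
    rw [neg_div, neg_neg, sq, one_div]
  have hpos : ∀ s ∈ Ioi (0:ℝ), 0 ≤ ((s + a) * (s + a))⁻¹ := fun s hs =>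
    inv_nonneg.mpr (mul_nonneg (add_pos hs ha).le (add_pos hs ha).le)
  have hlim : Tendsto (fun s : ℝ => -(s + a)⁻¹) atTop (𝓝 0) := by
    have h := (tendsto_atTop_add_const_right _ a tendsto_id).inv_tendsto_atTop
    simpa using h.neg
  refine ⟨integrableOn_Ioi_deriv_of_nonneg' hderiv hpos hlim, ?_⟩
  rw [integral_Ioi_of_hasDerivAt_of_nonneg' hderiv hpos hlim, dd1_log_self]
  simp

/-- **`∫₀^∞ ds/((s+a)(s+b)) = dd1 log a b`** for all `a, b > 0`: the entries of the Loewner matrix of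
`log` are the `s`-integrals of the entries `1/((μᵢ+s)(μⱼ+s))` of the resolvent sandwich
`(A₀+s)⁻¹ E (A₀+s)⁻¹` in an eigenbasis (Lieb 1973, (3.6)–(3.8)). [cite: Lieb1973ConvexTrace, eqs. (3.6)–(3.8)] -/
theorem integral_inv_mul_inv {a b : ℝ} (ha : 0 < a) (hb : 0 < b) :
    IntegrableOn (fun s : ℝ => ((s + a) * (s + b))⁻¹) (Ioi 0) ∧
    ∫ s in Ioi (0:ℝ), ((s + a) * (s + b))⁻¹ = dd1 Real.log a b := by
  by_cases hab : a = b
  · subst hab; exact integral_inv_mul_inv_self ha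
  · exact integral_inv_mul_inv_of_ne ha hb hab

/-- **`∫₀^∞ (1/(s+1) − 1/(s+x)) ds = log x`** for `x > 0` (Petz, Example 11.16:
"`log x = ∫₀^∞ (1/(1+t) − 1/(x+t)) dt`, which is easy to verify"; Lieb 1973, eq. (3.7)).
[cite: Petz2008, Example 11.16] -/
theorem integral_inv_add_one_sub_inv_add {x : ℝ} (hx : 0 < x) :
    IntegrableOn (fun s : ℝ => (s + 1)⁻¹ - (s + x)⁻¹) (Ioi 0) ∧
    ∫ s in Ioi (0:ℝ), ((s + 1)⁻¹ - (s + x)⁻¹) = Real.log x := by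
  obtain ⟨hint, hval⟩ := integral_inv_mul_inv one_pos hx
  have heq : (fun s : ℝ => (s + 1)⁻¹ - (s + x)⁻¹) =ᵐ[volume.restrict (Ioi (0:ℝ))]
      fun s => (x - 1) * ((s + 1) * (s + x))⁻¹ := by
    filter_upwards [ae_restrict_mem measurableSet_Ioi] with s hs
    have h1 : s + 1 ≠ 0 := (add_pos hs one_pos).ne'
    have h2 : s + x ≠ 0 := (add_pos hs hx).ne'
    field_simp
    ring
  refine ⟨(hint.const_mul (x - 1)).congr heq.symm, ?_⟩
  rw [integral_congr_ae heq, integral_const_mul, hval]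
  by_cases h1 : (1:ℝ) = x
  · subst h1; simp
  · rw [dd1_of_ne _ h1, Real.log_one]
    field_simp
    ring

end Scalar

/-! ### Algebra of a unitary diagonalisation `V diag(d) V⋆` -/

section ConjDiagonal

variable {V : Matrix n n ℂ}

/-- `(V diag d V⋆)(V diag e V⋆) = V diag(d e) V⋆` for unitary `V`. [folklore] -/
private theorem conj_diagonal_mul_conj_diagonal' (hV : V ∈ Matrix.unitaryGroup n ℂ) (d e : n → ℂ) :
    V * diagonal d * star V * (V * diagonal e * star V) = V * diagonal (fun k => d k * e k) * star V := by
  have h1 : star V * V = 1 := Unitary.star_mul_self_of_mem hV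
  calc V * diagonal d * star V * (V * diagonal e * star V)
      = V * diagonal d * (star V * V) * diagonal e * star V := by simp only [Matrix.mul_assoc]
    _ = V * diagonal (fun k => d k * e k) * star V := by rw [h1, Matrix.mul_one, Matrix.mul_assoc V, diagonal_mul_diagonal]

/-- `V diag(d) V⋆ + c·1 = V diag(d + c) V⋆` for unitary `V`. [folklore] -/
private theorem conj_diagonal_add_smul_one (hV : V ∈ Matrix.unitaryGroup n ℂ) (d : n → ℂ) (c : ℂ) :
    V * diagonal d * star V + c • (1 : Matrix n n ℂ) = V * diagonal (fun k => d k + c) * star V := by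
  have h2 : V * star V = 1 := Unitary.mul_star_self_of_mem hV
  calc V * diagonal d * star V + c • (1 : Matrix n n ℂ)
      = V * diagonal d * star V + V * (c • (1 : Matrix n n ℂ)) * star V := by
        rw [Matrix.mul_smul, Matrix.mul_one, Matrix.smul_mul, h2]
    _ = V * (diagonal d + c • (1 : Matrix n n ℂ)) * star V := by rw [Matrix.mul_add, Matrix.add_mul]
    _ = V * diagonal (fun k => d k + c) * star V := by rw [smul_one_eq_diagonal, diagonal_add]

/-- `V diag(d) V⋆ − V diag(e) V⋆ = V diag(d − e) V⋆`. [folklore] -/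
private theorem conj_diagonal_sub_conj_diagonal (V : Matrix n n ℂ) (d e : n → ℂ) :
    V * diagonal d * star V - V * diagonal e * star V = V * diagonal (fun k => d k - e k) * star V := by
  rw [← Matrix.sub_mul, ← Matrix.mul_sub, diagonal_sub]

/-- The inverse of `V diag(d) V⋆` (`V` unitary, `dₖ ≠ 0`) is `V diag(d⁻¹) V⋆`; stated as
`(V diag d V⋆)(V diag d⁻¹ V⋆) = 1`. [folklore] -/
private theorem conj_diagonal_mul_conj_diagonal_inv (hV : V ∈ Matrix.unitaryGroup n ℂ) {d : n → ℂ}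
    (hd : ∀ k, d k ≠ 0) :
    V * diagonal d * star V * (V * diagonal (fun k => (d k)⁻¹) * star V) = 1 := by
  rw [conj_diagonal_mul_conj_diagonal' hV]
  have : (fun k => d k * (d k)⁻¹) = fun _ => (1 : ℂ) := funext fun k => mul_inv_cancel₀ (hd k)
  rw [this, diagonal_one, Matrix.mul_one, Unitary.mul_star_self_of_mem hV]

omit [DecidableEq n] in
/-- `⟨v, V M V⋆ v⟩ = ⟨V⋆v, M V⋆v⟩`. [folklore] -/
private theorem star_dotProduct_conj_mulVec (V M : Matrix n n ℂ) (v : n → ℂ) :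
    star v ⬝ᵥ ((V * M * star V) *ᵥ v) = star (star V *ᵥ v) ⬝ᵥ (M *ᵥ (star V *ᵥ v)) := by
  rw [← mulVec_mulVec, ← mulVec_mulVec, dotProduct_mulVec, star_mulVec, star_eq_conjTranspose,
    conjTranspose_conjTranspose]

/-- `⟨w, diag(d) w⟩ = Σₖ dₖ ‖wₖ‖²`. [folklore] -/
private theorem star_dotProduct_diagonal_mulVec_eq_sum (d : n → ℂ) (w : n → ℂ) :
    star w ⬝ᵥ (diagonal d *ᵥ w) = ∑ k, d k * ((‖w k‖ ^ 2 : ℝ) : ℂ) := by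
  simp only [dotProduct, mulVec_diagonal, Pi.star_apply]
  refine Finset.sum_congr rfl fun k _ => ?_
  have : star (w k) * w k = ((‖w k‖ ^ 2 : ℝ) : ℂ) := by
    rw [Complex.star_def, Complex.conj_mul', Complex.ofReal_pow]
  rw [← this]
  ring

/-- `⟨w, (D Ẽ D') w⟩ = Σᵢⱼ conj(wᵢ) dᵢ Ẽᵢⱼ d'ⱼ wⱼ` for diagonal `D, D'`. [folklore] -/
private theorem star_dotProduct_diagonal_mul_mul_diagonal_mulVec (d e : n → ℂ) (M : Matrix n n ℂ) (w : n → ℂ) :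
    star w ⬝ᵥ ((diagonal d * M * diagonal e) *ᵥ w) = ∑ i, ∑ j, star (w i) * (d i * M i j * e j) * w j := by
  simp only [dotProduct, mulVec, Pi.star_apply, Finset.mul_sum]
  refine Finset.sum_congr rfl fun i _ => Finset.sum_congr rfl fun j _ => ?_
  rw [mul_diagonal, diagonal_mul]
  ring

omit [DecidableEq n] in
/-- `⟨w, (L ∘ M) w⟩ = Σᵢⱼ conj(wᵢ) Lᵢⱼ Mᵢⱼ wⱼ` (Hadamard product). [folklore] -/
private theorem star_dotProduct_hadamard_mulVec_eq_sum (L M : Matrix n n ℂ) (w : n → ℂ) :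
    star w ⬝ᵥ ((L ⊙ M) *ᵥ w) = ∑ i, ∑ j, star (w i) * (L i j * M i j) * w j := by
  simp only [dotProduct, mulVec, Pi.star_apply, Finset.mul_sum, hadamard_apply]
  refine Finset.sum_congr rfl fun i _ => Finset.sum_congr rfl fun j _ => ?_
  ring

end ConjDiagonal

/-! ### The Loewner matrix of `log` and the derivative map `logFrechet` -/

section Defs

/-- The **Loewner matrix of `log`** at the points `μ`: `Lᵢⱼ = dd1 log μᵢ μⱼ = (log μᵢ − log μⱼ)/(μᵢ − μⱼ)`
for `μᵢ ≠ μⱼ` and `Lᵢᵢ = 1/μᵢ` (complex entries). [cite: Petz2008, Example 11.7 eq. (11.13)] -/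
def logLoewnerMatrix (μ : n → ℝ) : Matrix n n ℂ :=
  Matrix.of fun i j => ((dd1 Real.log (μ i) (μ j) : ℝ) : ℂ)

omit [Fintype n] [DecidableEq n] in
/-- Entries of the Loewner matrix. [cite: Petz2008, Example 11.7 eq. (11.13)] -/
@[simp] theorem logLoewnerMatrix_apply (μ : n → ℝ) (i j : n) :
    logLoewnerMatrix μ i j = ((dd1 Real.log (μ i) (μ j) : ℝ) : ℂ) := rfl

omit [Fintype n] [DecidableEq n] in
/-- The Loewner matrix of `log` is Hermitian (real symmetric). [cite: Petz2008, Example 11.7 eq. (11.13)] -/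
theorem isHermitian_logLoewnerMatrix (μ : n → ℝ) : (logLoewnerMatrix μ).IsHermitian := by
  classical
  ext i j
  simp [logLoewnerMatrix, conjTranspose_apply, dd1_comm Real.log (μ j) (μ i)]

/-- The **Fréchet derivative of the matrix logarithm** at `A₀ = V diag(μ) V⋆`, applied to `E`:
`dlog_{A₀}[E] = V (L ∘ (V⋆ E V)) V⋆` with `L` the Loewner matrix of `log` at `μ` — the
Hadamard-product ("divided difference") form of the derivative of a matrix function
(Petz, Example 11.7 (11.12); Daleckiĭ–Kreĭn), written for an arbitrary unitary diagonalisation.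
[cite: Petz2008, Example 11.7 eq. (11.12)] [cite: Lieb1973ConvexTrace, eq. (3.6)] -/
def logFrechet (V : Matrix n n ℂ) (μ : n → ℝ) (E : Matrix n n ℂ) : Matrix n n ℂ :=
  V * (logLoewnerMatrix μ ⊙ (star V * E * V)) * star V

omit [DecidableEq n] in
/-- `logFrechet` is additive in `E`. [cite: Petz2008, Example 11.7 eq. (11.12)] -/
theorem logFrechet_add (V : Matrix n n ℂ) (μ : n → ℝ) (E F : Matrix n n ℂ) :
    logFrechet V μ (E + F) = logFrechet V μ E + logFrechet V μ F := by
  simp only [logFrechet, Matrix.mul_add, Matrix.add_mul, hadamard_add]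

omit [DecidableEq n] in
/-- `logFrechet` is homogeneous. [cite: Petz2008, Example 11.7 eq. (11.12)] -/
theorem logFrechet_smul (V : Matrix n n ℂ) (μ : n → ℝ) (c : ℂ) (E : Matrix n n ℂ) :
    logFrechet V μ (c • E) = c • logFrechet V μ E := by
  simp only [logFrechet, Matrix.mul_smul, Matrix.smul_mul, hadamard_smul]

omit [DecidableEq n] in
/-- `logFrechet` is compatible with subtraction. [cite: Petz2008, Example 11.7 eq. (11.12)] -/
theorem logFrechet_sub (V : Matrix n n ℂ) (μ : n → ℝ) (E F : Matrix n n ℂ) :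
    logFrechet V μ (E - F) = logFrechet V μ E - logFrechet V μ F := by
  rw [sub_eq_add_neg, logFrechet_add, ← neg_one_smul ℂ F, logFrechet_smul, neg_one_smul,
    ← sub_eq_add_neg]

omit [DecidableEq n] in
/-- `dlog[E]` is Hermitian for Hermitian `E`. [cite: Petz2008, Example 11.7 eq. (11.12)] -/
theorem isHermitian_logFrechet (V : Matrix n n ℂ) (μ : n → ℝ) {E : Matrix n n ℂ} (hE : E.IsHermitian) :
    (logFrechet V μ E).IsHermitian := by
  classical
  have h1 : (star V * E * V).IsHermitian := by
    have := isHermitian_conjTranspose_mul_mul V hE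
    simpa [star_eq_conjTranspose] using this
  have h2 : (logLoewnerMatrix μ ⊙ (star V * E * V)).IsHermitian := (isHermitian_logLoewnerMatrix μ).hadamard h1
  have := isHermitian_mul_mul_conjTranspose V h2
  simpa [logFrechet, star_eq_conjTranspose] using this

omit [DecidableEq n] in
/-- **Quadratic form of `dlog`**: with `w = V⋆v`, `Ẽ = V⋆EV`,
`⟨v, dlog[E] v⟩ = Σᵢⱼ conj(wᵢ) Lᵢⱼ Ẽᵢⱼ wⱼ`. [cite: Petz2008, Example 11.7 eq. (11.12)] -/
theorem star_dotProduct_logFrechet_mulVec (V : Matrix n n ℂ) (μ : n → ℝ) (E : Matrix n n ℂ) (v : n → ℂ) :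
    star v ⬝ᵥ (logFrechet V μ E *ᵥ v) =
      ∑ i, ∑ j, star ((star V *ᵥ v) i) * (logLoewnerMatrix μ i j * (star V * E * V) i j) * (star V *ᵥ v) j := by
  rw [logFrechet, star_dotProduct_conj_mulVec, star_dotProduct_hadamard_mulVec_eq_sum]

/-- **`dlog_{A₀}[A₀] = 1`** (`V` unitary, `μₖ ≠ 0`): `V⋆A₀V = diag μ` and `L ∘ diag μ = diag(μₖ/μₖ) = 1`.
[cite: Lieb1973ConvexTrace, Lemma 5 and eq. (3.10)] -/
theorem logFrechet_self {V : Matrix n n ℂ} (hV : V ∈ Matrix.unitaryGroup n ℂ) {μ : n → ℝ}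
    (hμ : ∀ k, μ k ≠ 0) :
    logFrechet V μ (V * diagonal (fun k => ((μ k : ℝ) : ℂ)) * star V) = 1 := by
  have h1 : star V * V = 1 := Unitary.star_mul_self_of_mem hV
  have h2 : V * star V = 1 := Unitary.mul_star_self_of_mem hV
  have hD : star V * (V * diagonal (fun k => ((μ k : ℝ) : ℂ)) * star V) * V = diagonal (fun k => ((μ k : ℝ) : ℂ)) := by
    calc star V * (V * diagonal (fun k => ((μ k : ℝ) : ℂ)) * star V) * V
        = (star V * V) * diagonal (fun k => ((μ k : ℝ) : ℂ)) * (star V * V) := by simp only [Matrix.mul_assoc]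
      _ = _ := by rw [h1, Matrix.one_mul, Matrix.mul_one]
  have hL : logLoewnerMatrix μ ⊙ diagonal (fun k => ((μ k : ℝ) : ℂ)) = 1 := by
    ext i j
    by_cases hij : i = j
    · subst hij
      rw [hadamard_apply, logLoewnerMatrix_apply, diagonal_apply_eq, one_apply_eq, dd1_log_self,
        ← Complex.ofReal_mul, inv_mul_cancel₀ (hμ i), Complex.ofReal_one]
    · rw [hadamard_apply, diagonal_apply_ne _ hij, mul_zero, one_apply_ne hij]
  rw [logFrechet, hD, hL, Matrix.mul_one, h2]

omit [DecidableEq n] in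
/-- **Trace-self-adjointness**: `Tr(C · dlog[E]) = Tr(dlog[C] · E)` (any `V`); both sides equal
`Σᵢⱼ Lᵢⱼ (V⋆CV)ⱼᵢ (V⋆EV)ᵢⱼ` and `L` is symmetric. [cite: Lieb1973ConvexTrace, eq. (3.12)] -/
theorem trace_mul_logFrechet_comm (V : Matrix n n ℂ) (μ : n → ℝ) (C E : Matrix n n ℂ) :
    (C * logFrechet V μ E).trace = (logFrechet V μ C * E).trace := by
  -- `Tr(C · V X V⋆) = Tr((V⋆CV) X)` and `Tr(V X V⋆ · E) = Tr(X (V⋆EV))`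
  have key : ∀ X Y : Matrix n n ℂ, (Y * (V * X * star V)).trace = ((star V * Y * V) * X).trace := by
    intro X Y
    calc (Y * (V * X * star V)).trace = (star V * (Y * (V * X))).trace := by
            rw [← Matrix.mul_assoc, Matrix.trace_mul_comm]
      _ = ((star V * Y * V) * X).trace := by simp only [Matrix.mul_assoc]
  have key' : ∀ X Y : Matrix n n ℂ, ((V * X * star V) * Y).trace = (X * (star V * Y * V)).trace := by
    intro X Y
    calc ((V * X * star V) * Y).trace = (V * (X * (star V * Y))).trace := by simp only [Matrix.mul_assoc]
      _ = ((X * (star V * Y)) * V).trace := Matrix.trace_mul_comm _ _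
      _ = (X * (star V * Y * V)).trace := by simp only [Matrix.mul_assoc]
  rw [logFrechet, logFrechet, key, key']
  set C' := star V * C * V
  set E' := star V * E * V
  simp only [Matrix.trace, Matrix.diag, Matrix.mul_apply, hadamard_apply, logLoewnerMatrix_apply]
  refine Finset.sum_congr rfl fun i _ => Finset.sum_congr rfl fun j _ => ?_
  rw [dd1_comm Real.log (μ j) (μ i)]
  ring

end Defs

/-! ### Resolvents and the integral representations -/

section Integral

variable {V : Matrix n n ℂ} {μ : n → ℝ} {A₀ : Matrix n n ℂ}

/-- The resolvent of `A₀ = V diag(μ) V⋆` at `−s` (`μₖ + s ≠ 0`): the matrix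
`R = V diag((μₖ+s)⁻¹) V⋆` satisfies `(A₀ + s) R = 1`. [cite: Lieb1973ConvexTrace, eq. (3.8)] -/
theorem add_smul_one_mul_resolvent (hV : V ∈ Matrix.unitaryGroup n ℂ)
    (hAV : A₀ = V * diagonal (fun k => ((μ k : ℝ) : ℂ)) * star V) {s : ℝ} (hs : ∀ k, μ k + s ≠ 0) :
    (A₀ + (s : ℂ) • (1 : Matrix n n ℂ)) * (V * diagonal (fun k => (((μ k + s)⁻¹ : ℝ) : ℂ)) * star V) = 1 := by
  rw [hAV, conj_diagonal_add_smul_one hV]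
  have h : (fun k => (((μ k + s)⁻¹ : ℝ) : ℂ)) = fun k => (((μ k : ℝ) : ℂ) + (s : ℂ))⁻¹ := by
    funext k; push_cast; rfl
  rw [h]
  exact conj_diagonal_mul_conj_diagonal_inv hV fun k => by exact_mod_cast hs k

/-- **Quadratic form of the resolvent**: `Re⟨v, V diag((μ+s)⁻¹) V⋆ v⟩ = Σₖ ‖wₖ‖²/(μₖ+s)`, `w = V⋆v`.
[cite: Lieb1973ConvexTrace, eq. (3.7)] -/
theorem re_star_dotProduct_resolvent_mulVec (V : Matrix n n ℂ) (μ : n → ℝ) (s : ℝ) (v : n → ℂ) :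
    (star v ⬝ᵥ ((V * diagonal (fun k => (((μ k + s)⁻¹ : ℝ) : ℂ)) * star V) *ᵥ v)).re =
      ∑ k, ‖(star V *ᵥ v) k‖ ^ 2 * (s + μ k)⁻¹ := by
  rw [star_dotProduct_conj_mulVec, star_dotProduct_diagonal_mulVec_eq_sum, Complex.re_sum]
  refine Finset.sum_congr rfl fun k _ => ?_
  rw [← Complex.ofReal_mul, Complex.ofReal_re, add_comm (μ k) s, mul_comm]

/-- **Quadratic form of a function of `A₀`**: `Re⟨v, f(A₀) v⟩ = Σₖ ‖wₖ‖² f(μₖ)`, `w = V⋆v`, for ANY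
unitary diagonalisation (`cfc_eq_conj_diagonal`). [cite: HornJohnson2013, §4.1 Theorem 4.1.5] -/
theorem re_star_dotProduct_cfc_mulVec (hV : V ∈ Matrix.unitaryGroup n ℂ)
    (hAV : A₀ = V * diagonal (fun k => ((μ k : ℝ) : ℂ)) * star V) (f : ℝ → ℝ) (v : n → ℂ) :
    (star v ⬝ᵥ (cfc f A₀ *ᵥ v)).re = ∑ k, ‖(star V *ᵥ v) k‖ ^ 2 * f (μ k) := by
  have hcfc : cfc f A₀ = V * diagonal (fun k => ((f (μ k) : ℝ) : ℂ)) * star V := cfc_eq_conj_diagonal hV hAV f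
  rw [hcfc, star_dotProduct_conj_mulVec, star_dotProduct_diagonal_mulVec_eq_sum, Complex.re_sum]
  refine Finset.sum_congr rfl fun k _ => ?_
  rw [← Complex.ofReal_mul, Complex.ofReal_re, mul_comm]

/-- `Re⟨v, v⟩ = Σₖ ‖(V⋆v)ₖ‖²` for unitary `V`. [folklore] -/
private theorem re_star_dotProduct_self_eq_sum (hV : V ∈ Matrix.unitaryGroup n ℂ) (v : n → ℂ) :
    (star v ⬝ᵥ v).re = ∑ k, ‖(star V *ᵥ v) k‖ ^ 2 := by
  have h2 : V * star V = 1 := Unitary.mul_star_self_of_mem hV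
  have : star v ⬝ᵥ v = star (star V *ᵥ v) ⬝ᵥ (star V *ᵥ v) := by
    calc star v ⬝ᵥ v = star v ⬝ᵥ ((V * star V) *ᵥ v) := by rw [h2, one_mulVec]
      _ = star (star V *ᵥ v) ⬝ᵥ (star V *ᵥ v) := by
          rw [← mulVec_mulVec, dotProduct_mulVec, star_mulVec, star_eq_conjTranspose,
            conjTranspose_conjTranspose]
  rw [this]
  simp only [dotProduct, Pi.star_apply, Complex.re_sum]
  refine Finset.sum_congr rfl fun k _ => ?_
  rw [Complex.star_def, Complex.conj_mul', ← Complex.ofReal_pow, Complex.ofReal_re]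

/-- **Quadratic form of the resolvent sandwich**:
`Re⟨v, R E R v⟩ = Σᵢⱼ Re(conj(wᵢ) Ẽᵢⱼ wⱼ)/((s+μᵢ)(s+μⱼ))` with `R = V diag((μ+s)⁻¹) V⋆`, `w = V⋆v`,
`Ẽ = V⋆EV`. [cite: Lieb1973ConvexTrace, eqs. (3.3), (3.8)] -/
theorem re_star_dotProduct_resolvent_sandwich_mulVec (hV : V ∈ Matrix.unitaryGroup n ℂ) (μ : n → ℝ)
    (E : Matrix n n ℂ) (s : ℝ) (v : n → ℂ) :
    (star v ⬝ᵥ (((V * diagonal (fun k => (((μ k + s)⁻¹ : ℝ) : ℂ)) * star V) * E *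
        (V * diagonal (fun k => (((μ k + s)⁻¹ : ℝ) : ℂ)) * star V)) *ᵥ v)).re =
      ∑ i, ∑ j, (star ((star V *ᵥ v) i) * (star V * E * V) i j * (star V *ᵥ v) j).re *
        ((s + μ i) * (s + μ j))⁻¹ := by
  have h1 : star V * V = 1 := Unitary.star_mul_self_of_mem hV
  set D : Matrix n n ℂ := diagonal (fun k => (((μ k + s)⁻¹ : ℝ) : ℂ)) with hD
  have hre : (V * D * star V) * E * (V * D * star V) = V * (D * (star V * E * V) * D) * star V := by
    simp only [Matrix.mul_assoc]
  rw [hre, star_dotProduct_conj_mulVec, hD, star_dotProduct_diagonal_mul_mul_diagonal_mulVec,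
    Complex.re_sum]
  refine Finset.sum_congr rfl fun i _ => ?_
  rw [Complex.re_sum]
  refine Finset.sum_congr rfl fun j _ => ?_
  have hij : ((((s + μ i) * (s + μ j))⁻¹ : ℝ) : ℂ) = (((μ i + s)⁻¹ : ℝ) : ℂ) * (((μ j + s)⁻¹ : ℝ) : ℂ) := by
    rw [← Complex.ofReal_mul, ← mul_inv, add_comm s (μ i), add_comm s (μ j)]
  have : star ((star V *ᵥ v) i) * ((((μ i + s)⁻¹ : ℝ) : ℂ) * (star V * E * V) i j * (((μ j + s)⁻¹ : ℝ) : ℂ)) *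
      (star V *ᵥ v) j = (star ((star V *ᵥ v) i) * (star V * E * V) i j * (star V *ᵥ v) j) *
        ((((μ i + s)⁻¹ : ℝ) : ℂ) * (((μ j + s)⁻¹ : ℝ) : ℂ)) := by
    ring
  rw [this, ← hij, Complex.re_mul_ofReal]

/-- **Resolvent (integral) form of the derivative of `log`**:
`Re⟨v, dlog_{A₀}[E] v⟩ = ∫₀^∞ Re⟨v, (A₀+s)⁻¹ E (A₀+s)⁻¹ v⟩ ds` (`A₀ = V diag(μ) V⋆`, `μ > 0`), with the
integrand integrable. This is Lieb's `T_{A₀}(E) = ∫₀^∞ (A₀+s)⁻¹E(A₀+s)⁻¹ ds` (eq. (3.3)) identified with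
the Loewner–Hadamard form (Petz (11.12)) entrywise by `∫₀^∞ ds/((s+μᵢ)(s+μⱼ)) = dd1 log μᵢ μⱼ`; in
particular `logFrechet V μ` does not depend on the diagonalisation `(V, μ)` of `A₀`.
[cite: Lieb1973ConvexTrace, eqs. (3.3), (3.6)] [cite: Petz2008, Example 11.7 eq. (11.12)] -/
theorem re_star_dotProduct_logFrechet_mulVec_eq_integral (hV : V ∈ Matrix.unitaryGroup n ℂ)
    (hμ : ∀ k, 0 < μ k) (E : Matrix n n ℂ) (v : n → ℂ) :
    IntegrableOn (fun s : ℝ => (star v ⬝ᵥ (((V * diagonal (fun k => (((μ k + s)⁻¹ : ℝ) : ℂ)) * star V) * E *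
        (V * diagonal (fun k => (((μ k + s)⁻¹ : ℝ) : ℂ)) * star V)) *ᵥ v)).re) (Ioi 0) ∧
    (star v ⬝ᵥ (logFrechet V μ E *ᵥ v)).re =
      ∫ s in Ioi (0:ℝ), (star v ⬝ᵥ (((V * diagonal (fun k => (((μ k + s)⁻¹ : ℝ) : ℂ)) * star V) * E *
        (V * diagonal (fun k => (((μ k + s)⁻¹ : ℝ) : ℂ)) * star V)) *ᵥ v)).re := by
  set w : n → ℂ := star V *ᵥ v with hw
  set E' : Matrix n n ℂ := star V * E * V with hE'
  have hfun : (fun s : ℝ => (star v ⬝ᵥ (((V * diagonal (fun k => (((μ k + s)⁻¹ : ℝ) : ℂ)) * star V) * E *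
        (V * diagonal (fun k => (((μ k + s)⁻¹ : ℝ) : ℂ)) * star V)) *ᵥ v)).re) =
      fun s => ∑ i, ∑ j, (star (w i) * E' i j * w j).re * ((s + μ i) * (s + μ j))⁻¹ := by
    funext s
    exact re_star_dotProduct_resolvent_sandwich_mulVec hV μ E s v
  have hint : ∀ i j, IntegrableOn (fun s : ℝ => (star (w i) * E' i j * w j).re * ((s + μ i) * (s + μ j))⁻¹)
      (Ioi 0) := fun i j => ((integral_inv_mul_inv (hμ i) (hμ j)).1.const_mul _)
  refine ⟨?_, ?_⟩
  · rw [hfun]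
    exact integrable_finsetSum _ fun i _ => integrable_finsetSum _ fun j _ => hint i j
  rw [hfun, star_dotProduct_logFrechet_mulVec, Complex.re_sum,
    integral_finsetSum _ fun i _ => integrable_finsetSum _ fun j _ => hint i j]
  refine Finset.sum_congr rfl fun i _ => ?_
  rw [Complex.re_sum, integral_finsetSum _ fun j _ => hint i j]
  refine Finset.sum_congr rfl fun j _ => ?_
  rw [integral_const_mul, (integral_inv_mul_inv (hμ i) (hμ j)).2, logLoewnerMatrix_apply]
  have : star (w i) * (((dd1 Real.log (μ i) (μ j) : ℝ) : ℂ) * E' i j) * w j =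
      (star (w i) * E' i j * w j) * ((dd1 Real.log (μ i) (μ j) : ℝ) : ℂ) := by ring
  rw [this, Complex.re_mul_ofReal]

/-- **Integral representation of the logarithm's quadratic form**: for `A₀ = V diag(μ) V⋆` with
`μ > 0`, `Re⟨v, log A₀ v⟩ = ∫₀^∞ (Re⟨v,v⟩/(s+1) − Re⟨v,(A₀+s)⁻¹v⟩) ds` with integrable integrand
(`log x = ∫₀^∞ (1/(1+t) − 1/(x+t)) dt` entrywise in the eigenbasis). [cite: Petz2008, Example 11.16]
[cite: Lieb1973ConvexTrace, eq. (3.7)] -/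
theorem re_star_dotProduct_log_mulVec_eq_integral (hV : V ∈ Matrix.unitaryGroup n ℂ)
    (hAV : A₀ = V * diagonal (fun k => ((μ k : ℝ) : ℂ)) * star V) (hμ : ∀ k, 0 < μ k) (v : n → ℂ) :
    IntegrableOn (fun s : ℝ => (star v ⬝ᵥ v).re * (s + 1)⁻¹ -
      (star v ⬝ᵥ ((V * diagonal (fun k => (((μ k + s)⁻¹ : ℝ) : ℂ)) * star V) *ᵥ v)).re) (Ioi 0) ∧
    (star v ⬝ᵥ (cfc Real.log A₀ *ᵥ v)).re = ∫ s in Ioi (0:ℝ), ((star v ⬝ᵥ v).re * (s + 1)⁻¹ -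
      (star v ⬝ᵥ ((V * diagonal (fun k => (((μ k + s)⁻¹ : ℝ) : ℂ)) * star V) *ᵥ v)).re) := by
  set w : n → ℂ := star V *ᵥ v with hw
  have hfun : (fun s : ℝ => (star v ⬝ᵥ v).re * (s + 1)⁻¹ -
      (star v ⬝ᵥ ((V * diagonal (fun k => (((μ k + s)⁻¹ : ℝ) : ℂ)) * star V) *ᵥ v)).re) =
      fun s => ∑ k, ‖w k‖ ^ 2 * ((s + 1)⁻¹ - (s + μ k)⁻¹) := by
    funext s
    rw [re_star_dotProduct_self_eq_sum hV, re_star_dotProduct_resolvent_mulVec, Finset.sum_mul,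
      ← Finset.sum_sub_distrib]
    refine Finset.sum_congr rfl fun k _ => ?_
    ring
  have hint : ∀ k, IntegrableOn (fun s : ℝ => ‖w k‖ ^ 2 * ((s + 1)⁻¹ - (s + μ k)⁻¹)) (Ioi 0) :=
    fun k => (integral_inv_add_one_sub_inv_add (hμ k)).1.const_mul _
  refine ⟨?_, ?_⟩
  · rw [hfun]; exact integrable_finsetSum _ fun k _ => hint k
  rw [hfun, integral_finsetSum _ fun k _ => hint k, re_star_dotProduct_cfc_mulVec hV hAV]
  refine Finset.sum_congr rfl fun k _ => ?_
  rw [integral_const_mul, (integral_inv_add_one_sub_inv_add (hμ k)).2]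

end Integral

/-! ### The pointwise inequality and the tangent inequality for `log` -/

section Tangent

/-- **Variational lower bound for the inverse**: for Hermitian `Q ≥ 0` with a Hermitian right inverse
`R` (`Q R = 1`), `2 Re⟨u,v⟩ − Re⟨u, Q u⟩ ≤ Re⟨v, R v⟩` for all `u, v` — expand
`0 ≤ ⟨u − Rv, Q(u − Rv)⟩`. [folklore] -/
private theorem two_mul_re_sub_re_le_re_inv {Q R : Matrix n n ℂ} (hQ : Q.PosSemidef) (hR : R.IsHermitian)
    (hQR : Q * R = 1) (u v : n → ℂ) :
    2 * (star u ⬝ᵥ v).re - (star u ⬝ᵥ (Q *ᵥ u)).re ≤ (star v ⬝ᵥ (R *ᵥ v)).re := by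
  set y : n → ℂ := R *ᵥ v with hy
  clear_value y
  have hQy : Q *ᵥ y = v := by rw [hy, mulVec_mulVec, hQR, one_mulVec]
  have h0 : 0 ≤ (star (u - y) ⬝ᵥ (Q *ᵥ (u - y))).re := Complex.nonneg_iff.mp (hQ.dotProduct_mulVec_nonneg (u - y)) |>.1 |> fun h => by simpa using h
  have hexp : star (u - y) ⬝ᵥ (Q *ᵥ (u - y)) =
      star u ⬝ᵥ (Q *ᵥ u) - star u ⬝ᵥ v - star y ⬝ᵥ (Q *ᵥ u) + star y ⬝ᵥ v := by
    rw [mulVec_sub, hQy, star_sub, sub_dotProduct, dotProduct_sub, dotProduct_sub]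
    ring
  -- `⟨y, Q u⟩ = ⟨Q y, u⟩ = ⟨v, u⟩` and `Re⟨v,u⟩ = Re⟨u,v⟩`; `⟨y, v⟩ = ⟨v, R v⟩⋆`
  have h1 : star y ⬝ᵥ (Q *ᵥ u) = star v ⬝ᵥ u := by
    rw [dotProduct_mulVec, ← hQy, star_mulVec, hQ.1.eq]
  have h2 : (star v ⬝ᵥ u).re = (star u ⬝ᵥ v).re := by
    rw [star_dotProduct, Complex.star_def, Complex.conj_re]
  have h3 : (star y ⬝ᵥ v).re = (star v ⬝ᵥ (R *ᵥ v)).re := by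
    rw [hy, star_mulVec, ← dotProduct_mulVec, hR.eq]
  rw [hexp] at h0
  simp only [Complex.sub_re, Complex.add_re] at h0
  rw [h1, h2, h3] at h0
  subst hy
  linarith

variable {V : Matrix n n ℂ} {μ : n → ℝ} {A₀ A : Matrix n n ℂ}

/-- **The pointwise (resolvent) inequality**: for `A₀ = V diag(μ) V⋆`, `μ > 0`, `A` positive definite
(resolvent `R_A(s)` written in Mathlib's eigenbasis of `A`) and `s > 0`,
`Re⟨v, R_A(s) v⟩ ≥ Re⟨v, R₀(s) v⟩ − Re⟨v, R₀(s)(A − A₀)R₀(s) v⟩`, i.e.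
`(A₀+s)⁻¹ − (A+s)⁻¹ − (A₀+s)⁻¹(A−A₀)(A₀+s)⁻¹ ≤ 0` — the variational bound at `u = R₀(s) v`.
[cite: Petz2008, Example 11.16] -/
theorem re_resolvent_pointwise (hV : V ∈ Matrix.unitaryGroup n ℂ)
    (hAV : A₀ = V * diagonal (fun k => ((μ k : ℝ) : ℂ)) * star V) (hμ : ∀ k, 0 < μ k) (hA : A.PosDef)
    {s : ℝ} (hs : 0 < s) (v : n → ℂ) :
    (star v ⬝ᵥ ((V * diagonal (fun k => (((μ k + s)⁻¹ : ℝ) : ℂ)) * star V) *ᵥ v)).re -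
      (star v ⬝ᵥ (((V * diagonal (fun k => (((μ k + s)⁻¹ : ℝ) : ℂ)) * star V) * (A - A₀) *
        (V * diagonal (fun k => (((μ k + s)⁻¹ : ℝ) : ℂ)) * star V)) *ᵥ v)).re ≤
      (star v ⬝ᵥ (((hA.1.eigenvectorUnitary : Matrix n n ℂ) *
        diagonal (fun k => (((hA.1.eigenvalues k + s)⁻¹ : ℝ) : ℂ)) *
          star (hA.1.eigenvectorUnitary : Matrix n n ℂ)) *ᵥ v)).re := by
  set R₀ : Matrix n n ℂ := V * diagonal (fun k => (((μ k + s)⁻¹ : ℝ) : ℂ)) * star V with hR₀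
  set W : Matrix n n ℂ := (hA.1.eigenvectorUnitary : Matrix n n ℂ) with hW
  set R : Matrix n n ℂ := W * diagonal (fun k => (((hA.1.eigenvalues k + s)⁻¹ : ℝ) : ℂ)) * star W with hR
  set Q : Matrix n n ℂ := A + (s : ℂ) • (1 : Matrix n n ℂ) with hQ
  have hWu : W ∈ Matrix.unitaryGroup n ℂ := hA.1.eigenvectorUnitary.2
  have hAW : A = W * diagonal (fun k => ((hA.1.eigenvalues k : ℝ) : ℂ)) * star W := hA.1.spectral_theorem
  -- `Q R = 1`, `Q ≥ 0`, `R` Hermitian, `(A₀ + s) R₀ = 1`, `R₀` Hermitian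
  have hQR : Q * R = 1 :=
    add_smul_one_mul_resolvent hWu hAW fun k => (add_pos (hA.eigenvalues_pos k) hs).ne'
  have hQ0 : Q.PosSemidef :=
    hA.posSemidef.add (PosSemidef.one.smul (by exact_mod_cast hs.le))
  have hRh : R.IsHermitian := hR ▸ isHermitian_conj_diagonal W _
  have hR₀h : R₀.IsHermitian := hR₀ ▸ isHermitian_conj_diagonal V _
  have hA₀R₀ : (A₀ + (s : ℂ) • (1 : Matrix n n ℂ)) * R₀ = 1 :=
    add_smul_one_mul_resolvent hV hAV fun k => (add_pos (hμ k) hs).ne'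
  have hR₀A₀ : R₀ * (A₀ + (s : ℂ) • (1 : Matrix n n ℂ)) = 1 := mul_eq_one_comm.mp hA₀R₀
  -- the variational bound at `u = R₀ v`
  have hvar := two_mul_re_sub_re_le_re_inv hQ0 hRh hQR (R₀ *ᵥ v) v
  -- `Re⟨R₀v, v⟩ = Re⟨v, R₀ v⟩`
  have e1 : (star (R₀ *ᵥ v) ⬝ᵥ v).re = (star v ⬝ᵥ (R₀ *ᵥ v)).re := by
    rw [star_mulVec, ← dotProduct_mulVec, hR₀h.eq]
  -- `⟨R₀v, Q R₀v⟩ = ⟨v, R₀ Q R₀ v⟩` and `R₀ Q R₀ = R₀ + R₀ (A − A₀) R₀`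
  have e2 : star (R₀ *ᵥ v) ⬝ᵥ (Q *ᵥ (R₀ *ᵥ v)) = star v ⬝ᵥ ((R₀ * Q * R₀) *ᵥ v) := by
    rw [star_mulVec, hR₀h.eq, ← dotProduct_mulVec, mulVec_mulVec, mulVec_mulVec]
  have e3 : R₀ * Q * R₀ = R₀ + R₀ * (A - A₀) * R₀ := by
    have : Q = (A - A₀) + (A₀ + (s : ℂ) • (1 : Matrix n n ℂ)) := by rw [hQ]; abel
    rw [this, Matrix.mul_add, Matrix.add_mul, Matrix.mul_assoc R₀ (A₀ + _), hA₀R₀, Matrix.mul_one, add_comm]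
  rw [e1, e2, e3, add_mulVec, dotProduct_add, Complex.add_re] at hvar
  linarith

/-- **First-order (tangent) inequality for the operator concave function `log`**: for positive
definite `A` and `A₀ = V diag(μ) V⋆` (`V` unitary, `μ > 0`),
`log A ≤ log A₀ + dlog_{A₀}[A − A₀]` in the Löwner order, i.e.
`log A₀ + logFrechet V μ (A − A₀) − log A` is positive semidefinite. This is the supporting-hyperplane
form of the operator concavity of `log` (Petz, Example 11.16 / §11.6), obtained by integrating the
pointwise resolvent inequality `re_resolvent_pointwise` over `s ∈ (0, ∞)` against the integral
representations of `log` and of `dlog`. [cite: Petz2008, Example 11.16] [cite: Lieb1973ConvexTrace, eqs. (3.6)–(3.7)] -/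
theorem posSemidef_log_add_logFrechet_sub_log (hV : V ∈ Matrix.unitaryGroup n ℂ)
    (hAV : A₀ = V * diagonal (fun k => ((μ k : ℝ) : ℂ)) * star V) (hμ : ∀ k, 0 < μ k) (hA : A.PosDef) :
    (cfc Real.log A₀ + logFrechet V μ (A - A₀) - cfc Real.log A).PosSemidef := by
  have hA₀h : A₀.IsHermitian := hAV ▸ isHermitian_conj_diagonal V μ
  have hWu : (hA.1.eigenvectorUnitary : Matrix n n ℂ) ∈ Matrix.unitaryGroup n ℂ := hA.1.eigenvectorUnitary.2
  have hAW : A = (hA.1.eigenvectorUnitary : Matrix n n ℂ) *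
      diagonal (fun k => ((hA.1.eigenvalues k : ℝ) : ℂ)) * star (hA.1.eigenvectorUnitary : Matrix n n ℂ) :=
    hA.1.spectral_theorem
  have hherm : (cfc Real.log A₀ + logFrechet V μ (A - A₀) - cfc Real.log A).IsHermitian := by
    have h1 : (cfc Real.log A₀).IsHermitian := (cfc_predicate Real.log A₀ : IsSelfAdjoint _)
    have h2 : (cfc Real.log A).IsHermitian := (cfc_predicate Real.log A : IsSelfAdjoint _)
    exact (h1.add (isHermitian_logFrechet V μ (hA.1.sub hA₀h))).sub h2
  refine posSemidef_of_re_star_dotProduct_mulVec_nonneg hherm fun v => ?_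
  -- the three integral representations
  obtain ⟨hI0, hlog0⟩ := re_star_dotProduct_log_mulVec_eq_integral hV hAV hμ v
  obtain ⟨hIA, hlogA⟩ := re_star_dotProduct_log_mulVec_eq_integral hWu hAW (fun k => hA.eigenvalues_pos k) v
  obtain ⟨hIT, hT⟩ := re_star_dotProduct_logFrechet_mulVec_eq_integral hV hμ (A - A₀) v
  rw [sub_mulVec, add_mulVec, dotProduct_sub, dotProduct_add, Complex.sub_re, Complex.add_re, hlog0, hlogA, hT]
  have hmono := setIntegral_mono_on hIA (hI0.add hIT) measurableSet_Ioi fun s hs => by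
    simp only [Pi.add_apply]
    have h := re_resolvent_pointwise hV hAV hμ hA (Set.mem_Ioi.mp hs) v
    linarith
  rw [integral_add' hI0 hIT] at hmono
  linarith

/-- **Trace form of the tangent inequality**: for `X ≥ 0`,
`Re Tr(X log A) ≤ Re Tr(X log A₀) + Re Tr(X dlog_{A₀}[A − A₀])`. [cite: Petz2008, Example 11.16] -/
theorem re_trace_mul_log_le_of_logFrechet (hV : V ∈ Matrix.unitaryGroup n ℂ)
    (hAV : A₀ = V * diagonal (fun k => ((μ k : ℝ) : ℂ)) * star V) (hμ : ∀ k, 0 < μ k) (hA : A.PosDef)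
    {X : Matrix n n ℂ} (hX : X.PosSemidef) :
    (X * cfc Real.log A).trace.re ≤ (X * cfc Real.log A₀).trace.re + (X * logFrechet V μ (A - A₀)).trace.re := by
  have h := posSemidef_log_add_logFrechet_sub_log hV hAV hμ hA
  have h0 : 0 ≤ (X * (cfc Real.log A₀ + logFrechet V μ (A - A₀) - cfc Real.log A)).trace.re :=
    re_trace_mul_nonneg_of_posSemidef hX h
  rw [Matrix.mul_sub, Matrix.mul_add, Matrix.trace_sub, Matrix.trace_add, Complex.sub_re, Complex.add_re] at h0
  linarith

end Tangent

/-! ### Positivity of `dlog` and of the Loewner matrix -/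

section Positivity

variable {V : Matrix n n ℂ} {μ : n → ℝ}

/-- **`dlog` is a positive map**: `0 ≤ E ⇒ 0 ≤ dlog_{A₀}[E]` (`μ > 0`), since
`Re⟨v, dlog[E] v⟩ = ∫₀^∞ Re⟨R(s)v, E R(s)v⟩ ds ≥ 0` — no Schur product theorem needed.
[cite: Petz2008, Theorem 11.17] -/
theorem posSemidef_logFrechet (hV : V ∈ Matrix.unitaryGroup n ℂ) (hμ : ∀ k, 0 < μ k) {E : Matrix n n ℂ}
    (hE : E.PosSemidef) : (logFrechet V μ E).PosSemidef := by
  refine posSemidef_of_re_star_dotProduct_mulVec_nonneg (isHermitian_logFrechet V μ hE.1) fun v => ?_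
  obtain ⟨-, hT⟩ := re_star_dotProduct_logFrechet_mulVec_eq_integral hV hμ E v
  rw [hT]
  refine setIntegral_nonneg measurableSet_Ioi fun s _ => ?_
  set R : Matrix n n ℂ := V * diagonal (fun k => (((μ k + s)⁻¹ : ℝ) : ℂ)) * star V with hR
  have hRh : R.IsHermitian := hR ▸ isHermitian_conj_diagonal V _
  have : star v ⬝ᵥ ((R * E * R) *ᵥ v) = star (R *ᵥ v) ⬝ᵥ (E *ᵥ (R *ᵥ v)) := by
    rw [← mulVec_mulVec, ← mulVec_mulVec, dotProduct_mulVec, star_mulVec, hRh.eq]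
  rw [this]
  exact (Complex.nonneg_iff.mp (hE.dotProduct_mulVec_nonneg (R *ᵥ v))).1

/-- **Monotonicity of `dlog`**: `E ≤ F ⇒ dlog[E] ≤ dlog[F]` (as positive semidefiniteness of the
difference). [cite: Petz2008, Theorem 11.17] -/
theorem logFrechet_mono (hV : V ∈ Matrix.unitaryGroup n ℂ) (hμ : ∀ k, 0 < μ k) {E F : Matrix n n ℂ}
    (hEF : (F - E).PosSemidef) : (logFrechet V μ F - logFrechet V μ E).PosSemidef := by
  rw [← logFrechet_sub]
  exact posSemidef_logFrechet hV hμ hEF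

/-- **The Loewner matrix of `log` is positive semidefinite** at positive points (`log` is operator
monotone; Petz, Theorem 11.17 (⇒)): it is `dlog_{diag μ}[J]` for the all-ones matrix `J ≥ 0`.
[cite: Petz2008, Theorem 11.17] -/
theorem posSemidef_logLoewnerMatrix (hμ : ∀ k, 0 < μ k) : (logLoewnerMatrix μ).PosSemidef := by
  have h1 : (1 : Matrix n n ℂ) ∈ Matrix.unitaryGroup n ℂ := Submonoid.one_mem _
  have hJ : (Matrix.of fun _ _ : n => (1 : ℂ)).PosSemidef := by
    have : Matrix.of (fun _ _ : n => (1 : ℂ)) = vecMulVec (fun _ => (1:ℂ)) (star fun _ => (1:ℂ)) := by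
      ext i j; simp [vecMulVec_apply]
    rw [this]
    exact posSemidef_vecMulVec_self_star _
  have h := posSemidef_logFrechet h1 hμ hJ
  have e : logFrechet 1 μ (Matrix.of fun _ _ : n => (1 : ℂ)) = logLoewnerMatrix μ := by
    ext i j
    simp [logFrechet, hadamard_apply]
  rwa [e] at h

end Positivity

end Literature.LinearAlgebra.Matrix

end
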